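import Summits.ResolutionOfSingularities.ResolutionOfSingularities.Theorems.FrobeniusLadderFInjectiveMacaulayficationFCForallExistsDimLe2
import Summits.ResolutionOfSingularities.ResolutionOfSingularities.Theorems.FrobeniusLadderFInjectiveMacaulayficationFiniteModificationOfBlowup
import Summits.ResolutionOfSingularities.ResolutionOfSingularities.Theorems.FrobeniusLadderFInjectiveMacaulayficationFCForallExists
import Summits.ResolutionOfSingularities.ResolutionOfSingularities.Theorems.FrobeniusLadderFInjectiveMacaulayficationRegularPointClause
import Summits.ResolutionOfSingularities.ResolutionOfSingularities.Theorems.FrobeniusLadderFInjectiveMacaulayficationIsBlowupStalkTransfer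
import Summits.ResolutionOfSingularities.ResolutionOfSingularities.Theorems.FrobeniusLadderFInjectiveMacaulayficationIsBlowupStalkOffSupport
import Literature.AlgebraicGeometry.Resolution.BlowupAlgebraPrimesPoints
import Literature.AlgebraicGeometry.Resolution.KollarBlowupSequenceFunctors
import Literature.AlgebraicGeometry.Resolution.QuasiExcellentSchemes
import Literature.AlgebraicGeometry.Resolution.BlowupsIntegral
import Literature.AlgebraicGeometry.Resolution.BlowupsProperProofs
import Literature.AlgebraicGeometry.Resolution.BlowupDimension
import Literature.AlgebraicGeometry.Dimension.FibreLocalRingDimension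
import Mathlib.Algebra.CharP.Algebra
import HarnessLib

/-!
# FC′ (`stub_fcForallExists` of v29) SPLIT BY DIMENSION: the dim-3 rung from Cossart–Piltant 2019 BY NAME, FC′ from one regular blowing up,
# and the ladder kernel `stub_fcForallExists ⟸ S-S2 ∧ S-V1 ∧ S-V2 ∧ FC′(dim ≥ 4)` given the named facts
# (crux `FInjectiveMacaulayfication` stmt-ResolutionOfSingularities-15315, chain w45a, hole #3γ; res-L1-w45a-plan-1 R13.25 (2);
# text res-L1-w45a-strat-1 `FCRungsSig.lean` v2.4 §A/§C, filer res-D-pv-019 (stub-7))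

[OURS · L1 W4.5a] Support file (`--supports stmt-ResolutionOfSingularities-15315 --as helper`); NOT a statement of any manuscript; no named
fact introduced (Cossart–Piltant 2019 / Stacks 081R / Datta–Murayama are the tree's named facts, used BY NAME); AI-written (AI review is weaker
than expert review). Contents:

* `fc_witness_of_regular_blowup` — FC′'s seven-conjunct conclusion at `η` from ONE regular blowing up of `X₁` (any dimension; sorry-free);
* `FCForallExistsDimEq3` (`@[conjecture] def`, = `GenericFibreReduction.FCForallExists` VERBATIM + `topologicalKrullDim X₁ = 3`) and
  (VARIANT B: the discharge `fcForallExistsDimEq3_of_CP` from the CP2019 / Stacks 081R named facts is kept in the cell until those facts are FACT-LIST §A entries — plan-1 R13.26 (1));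
* `fcForallExists_of_oneBlowupResolution` — FC′ from one-blow-up resolution in all dimensions (sanity: FC′ is not a strengthening of resolution);
* `FCForallExistsDimGe4` (`@[conjecture] def`, the RESIDUAL: FC′ VERBATIM + `4 ≤ topologicalKrullDim X₁`), `dim_trichotomy`,
  `fcForallExists_of_rungs : FC′(≤2) → FC′(=3) → FC′(≥4) → FC′`, `rungs_of_fcForallExists` (converse), and the ladder kernels
  `fcForallExists_of_dimGe4_named` / `fcForallExists_of_dimGe4_named'` : given Datta–Murayama (BY NAME), `CMLocusOpen`, the CP2019/081R facts,
  `stub_fcForallExists ⟸ S2Modification ∧ FiniteModificationOfBlowupIsBlowup ∧ FC′(dim ≥ 4)`, resp. `⟸ S2Modification ∧ ConductorIdealExists ∧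
  IsBlowupOfFiniteOfStable ∧ FC′(dim ≥ 4)`. ALL REMAINING DIFFICULTY of the v29 stub sits in `FCForallExistsDimGe4` (census v4.6 §15: first
  test family = ν-first mixed models of the `D_red` cones, cf. `…FCForallExistsOfMixedModel`).

[folklore assembly; cite: CossartPiltant2019, Thm. 1.1; StacksProject, Tags 081R 0804 0805 02ND; DattaMurayama2024, Thm. B; Kunz1969, Thm. 2.1]
-/

-- single-problem summit: the doubled namespace component is forced
set_option linter.dupNamespace false

noncomputable section

open AlgebraicGeometry CategoryTheory Literature.AlgebraicGeometry.Resolution TopologicalSpace IsLocalRing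
open Scheme.IdealSheafData

namespace Summit.ResolutionOfSingularities.ResolutionOfSingularities.Theorems.FInjectiveMacaulayfication.FCForallExistsRungs

open Summit.ResolutionOfSingularities.ResolutionOfSingularities.Theorems.FInjectiveMacaulayfication
open Summit.ResolutionOfSingularities.ResolutionOfSingularities.Theorems.FInjectiveMacaulayfication.GenericFibreReduction
open Summit.ResolutionOfSingularities.ResolutionOfSingularities.Theorems.FInjectiveMacaulayfication.NonFullLocusClosed
open Summit.ResolutionOfSingularities.ResolutionOfSingularities.Theorems.FInjectiveMacaulayfication.FCForallExistsDimLe2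
open Summit.ResolutionOfSingularities.ResolutionOfSingularities.Theorems.FInjectiveMacaulayfication.FiniteModificationOfBlowup

/-! ## The conclusion of FC′ from a regular blowing up (any dimension) -/

/-- [OURS] **FC′'s conclusion at `η` from ONE regular blowing up of `X₁`.** `J := 𝓛`, `c' :=` generators of `𝓛_η`;
`η ∈ supp 𝓛` because otherwise `𝒪_{X₁,η} ≅ 𝒪_{T,t}` is regular, hence Frobenius-closed (Kunz), contradicting `hη`; the
charts of `Bl_(c')(Spec 𝒪_η)` over `𝔪_η` are local rings of `T` over `η` (Stacks 0804/0805 dictionary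
`IsBlowup.exists_point_of_blowupAlgebra_prime`), hence regular, hence FULL (`FiClauseOfRegular`); every blowing up `X₂` of
`𝓛` has the stalks of `T` (`IsBlowup.unique`), hence (nc) and (cl). [folklore assembly over the tree] -/
theorem fc_witness_of_regular_blowup (p : ℕ) (hp : p.Prime) (k : Type) [Field k] [CharP k p]
    (X₁ : Scheme.{0}) (f₁ : X₁ ⟶ Spec (.of k)) [LocallyOfFiniteType f₁] [QuasiCompact f₁] [IsIntegral X₁]
    (η : X₁)
    (hη : ¬ (∀ d : ℕ, ringKrullDim (X₁.presheaf.stalk η) = d → ∀ s : Fin d → X₁.presheaf.stalk η,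
          (Ideal.span (Set.range s)).radical.IsMaximal → ∀ t : X₁.presheaf.stalk η, (∃ e : ℕ, t ^ p ^ e ∈
            Ideal.span ((fun z : X₁.presheaf.stalk η => z ^ p ^ e) '' (Ideal.span (Set.range s) : Set (X₁.presheaf.stalk η)))) →
              t ∈ Ideal.span (Set.range s)))
    (𝓛 : X₁.IdealSheafData) (h𝓛 : 𝓛 ≠ ⊥) (T : Scheme.{0}) (ρ : T ⟶ X₁) (hbl : IsBlowup ρ 𝓛)
    (hreg : Scheme.IsRegular T) :
    ∃ (J : X₁.IdealSheafData) (n' : ℕ) (c' : Fin n' → X₁.presheaf.stalk η), J ≠ ⊥ ∧ η ∈ (J.support : Set X₁) ∧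
    -- the RE-CHOSEN LocFix datum c' at η (currency (A′)): nonzero, inside 𝔪_η, charts FULL over 𝔪_η
    Ideal.span (Set.range c') ≠ ⊥ ∧ Ideal.span (Set.range c') ≤ maximalIdeal (X₁.presheaf.stalk η) ∧
    (∀ (j : Fin n') (𝔔 : PrimeSpectrum (blowupAlgebra (Ideal.span (Set.range c')) (c' j))),
    𝔔.asIdeal.comap (algebraMap (X₁.presheaf.stalk η) (blowupAlgebra (Ideal.span (Set.range c')) (c' j))) =
    maximalIdeal (X₁.presheaf.stalk η) →
    IsDomain (Localization.AtPrime 𝔔.asIdeal) ∧ ∀ d : ℕ, ringKrullDim (Localization.AtPrime 𝔔.asIdeal) = d →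
    ∀ s : Fin d → Localization.AtPrime 𝔔.asIdeal, (Ideal.span (Set.range s)).radical.IsMaximal →
    RingTheory.Sequence.IsWeaklyRegular (Localization.AtPrime 𝔔.asIdeal) (List.ofFn s) ∧
    ∀ y : Localization.AtPrime 𝔔.asIdeal, (∃ e : ℕ, y ^ p ^ e ∈ Ideal.span ((fun z : Localization.AtPrime 𝔔.asIdeal => z ^ p ^ e) ''
    (Ideal.span (Set.range s) : Set (Localization.AtPrime 𝔔.asIdeal)))) → y ∈ Ideal.span (Set.range s)) ∧
    stalkIdeal J η = Ideal.span (Set.range c') ∧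
    (∀ (X₂ : Scheme.{0}) (π : X₂ ⟶ X₁), IsBlowup π J →
    (∀ x : X₂, π.base x ∈ (J.support : Set X₁) → π.base x ≠ η → ¬ IsClosed ({x} : Set X₂) →
    IsDomain (X₂.presheaf.stalk x) ∧ ∀ d : ℕ, ringKrullDim (X₂.presheaf.stalk x) = d → ∀ s : Fin d → X₂.presheaf.stalk x,
    (Ideal.span (Set.range s)).radical.IsMaximal → RingTheory.Sequence.IsWeaklyRegular (X₂.presheaf.stalk x) (List.ofFn s) ∧
    ∀ t : X₂.presheaf.stalk x, (∃ e : ℕ, t ^ p ^ e ∈ Ideal.span ((fun z : X₂.presheaf.stalk x => z ^ p ^ e) ''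
    (Ideal.span (Set.range s) : Set (X₂.presheaf.stalk x)))) → t ∈ Ideal.span (Set.range s)) ∧
    (∀ x : X₂, π.base x ∈ (J.support : Set X₁) → IsClosed ({x} : Set X₂) →
    ∀ d : ℕ, ringKrullDim (X₂.presheaf.stalk x) = d → ∀ s : Fin d → X₂.presheaf.stalk x,
    (Ideal.span (Set.range s)).radical.IsMaximal → RingTheory.Sequence.IsWeaklyRegular (X₂.presheaf.stalk x) (List.ofFn s))) := by
  classical
  haveI : Fact p.Prime := ⟨hp⟩
  haveI : IsNoetherian X₁ := Scheme.isNoetherian_of_finiteType_over_field f₁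
  -- characteristic `p` on the stalks of `T`
  have hcharT : ∀ t : T, CharP (T.presheaf.stalk t) p := fun t =>
    CharP.of_ringHom_of_ne_zero
      ((T.presheaf.germ ⊤ t trivial).hom.comp ((ρ ≫ f₁).appTop.hom.comp (Scheme.ΓSpecIso (.of k)).inv.hom)) p hp.ne_zero
  -- `η ∈ supp 𝓛`: else the stalk at `η` is regular, hence Frobenius closed
  have hηsupp : η ∈ (𝓛.support : Set X₁) := by
    by_contra hnot
    obtain ⟨t, ht⟩ := hbl.exists_preimage_of_not_mem_support hnot
    obtain ⟨e⟩ := IsBlowupStalkOffSupport.stub_isBlowupStalkOffSupport X₁ T 𝓛 ρ hbl t (by rw [ht]; exact hnot)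
    haveI : IsRegularLocalRing (T.presheaf.stalk t) := hreg t
    have hreg' : IsRegularLocalRing (X₁.presheaf.stalk (ρ.base t)) := IsRegularLocalRing.of_ringEquiv e
    have hcl := (RegularPointClause.fiClause_stalk_of_isRegularLocalRing p f₁ (ρ.base t) hreg').2
    apply hη
    have hη' : ρ.base t = η := ht
    rw [hη'] at hcl
    intro d hd s hs u hu
    exact (hcl d hd s hs).2 u hu
  -- `c'` := generators of the stalk ideal `𝓛_η`
  obtain ⟨n', c', hc'⟩ : ∃ (n' : ℕ) (c' : Fin n' → X₁.presheaf.stalk η),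
      Ideal.span (Set.range c') = stalkIdeal 𝓛 η :=
    Submodule.fg_iff_exists_fin_generating_family.mp (IsNoetherian.noetherian _)
  refine ⟨𝓛, n', c', h𝓛, hηsupp, ?_, ?_, ?_, hc'.symm, ?_⟩
  · rw [hc']; exact stalkIdeal_ne_bot_of_ne_bot h𝓛 η
  · rw [hc']; exact (mem_support_iff_stalkIdeal_le 𝓛 η).mp hηsupp
  · intro j 𝔔 h𝔔
    obtain ⟨x', -, ⟨e⟩⟩ := hbl.exists_point_of_blowupAlgebra_prime η c' hc' j 𝔔 h𝔔
    haveI : IsRegularLocalRing (T.presheaf.stalk x') := hreg x'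
    haveI : IsRegularLocalRing (Localization.AtPrime 𝔔.asIdeal) := IsRegularLocalRing.of_ringEquiv e
    haveI : CharP (T.presheaf.stalk x') p := hcharT x'
    haveI : CharP (Localization.AtPrime 𝔔.asIdeal) p := charP_of_injective_ringHom (f := e.toRingHom) e.injective p
    exact FiClauseOfRegular.stub_fiClauseOfRegular p (Localization.AtPrime 𝔔.asIdeal)
  · intro X₂ π hπ
    have key : ∀ x : X₂, IsRegularLocalRing (X₂.presheaf.stalk x) := fun x => by
      obtain ⟨t, -, ⟨e⟩⟩ := IsBlowupStalkTransfer.stub_isBlowupStalkTransfer X₁ X₂ T 𝓛 π ρ hπ hbl x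
      haveI : IsRegularLocalRing (T.presheaf.stalk t) := hreg t
      exact IsRegularLocalRing.of_ringEquiv e.symm
    exact ⟨fun x _ _ _ => RegularPointClause.fiClause_stalk_of_isRegularLocalRing p (π ≫ f₁) x (key x),
      fun x _ _ d hd s hs => ((RegularPointClause.fiClause_stalk_of_isRegularLocalRing p (π ≫ f₁) x (key x)).2 d hd s hs).1⟩

/-! ## The dim-3 rung from Cossart–Piltant 2019 (tree named facts, BY NAME) -/

/-- [OURS] **FC′ restricted to threefolds** — `GenericFibreReduction.FCForallExists` VERBATIM with the single extra
hypothesis `topologicalKrullDim X₁ = 3` inserted after `IsIntegral X₁`. [candidate statement, OURS] -/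
@[conjecture] def FCForallExistsDimEq3 : Prop :=
  ∀ (p : ℕ), p.Prime → ∀ (k : Type) [Field k] [CharP k p]
    (X₁ : Scheme.{0}) (f₁ : X₁ ⟶ Spec (.of k)),
      IsSeparated f₁ → LocallyOfFiniteType f₁ → QuasiCompact f₁ → IsIntegral X₁ → topologicalKrullDim X₁ = 3 →
      (∀ x : X₁, (∀ d : ℕ, ringKrullDim (X₁.presheaf.stalk x) = d → ∀ s : Fin d → X₁.presheaf.stalk x,
        (Ideal.span (Set.range s)).radical.IsMaximal → RingTheory.Sequence.IsWeaklyRegular (X₁.presheaf.stalk x) (List.ofFn s))) →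
      ∀ η : X₁, (¬ IsClosed ({η} : Set X₁) ∧ ¬ (∀ d : ℕ, ringKrullDim (X₁.presheaf.stalk η) = d → ∀ s : Fin d → X₁.presheaf.stalk η,
          (Ideal.span (Set.range s)).radical.IsMaximal → ∀ t : X₁.presheaf.stalk η, (∃ e : ℕ, t ^ p ^ e ∈
            Ideal.span ((fun z : X₁.presheaf.stalk η => z ^ p ^ e) '' (Ideal.span (Set.range s) : Set (X₁.presheaf.stalk η)))) →
              t ∈ Ideal.span (Set.range s)) ∧
        ∀ y : X₁, y ⤳ η → y ≠ η → (∀ d : ℕ, ringKrullDim (X₁.presheaf.stalk y) = d → ∀ s : Fin d → X₁.presheaf.stalk y,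
          (Ideal.span (Set.range s)).radical.IsMaximal → ∀ t : X₁.presheaf.stalk y, (∃ e : ℕ, t ^ p ^ e ∈
            Ideal.span ((fun z : X₁.presheaf.stalk y => z ^ p ^ e) '' (Ideal.span (Set.range s) : Set (X₁.presheaf.stalk y)))) →
              t ∈ Ideal.span (Set.range s))) →
      ∀ (n : ℕ) (c : Fin n → X₁.presheaf.stalk η), Ideal.span (Set.range c) ≠ ⊥ →
        (Ideal.span (Set.range c)).radical = maximalIdeal (X₁.presheaf.stalk η) →
        (∀ (j : Fin n) (𝔔 : PrimeSpectrum (blowupAlgebra (Ideal.span (Set.range c)) (c j))),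
          𝔔.asIdeal.comap (algebraMap (X₁.presheaf.stalk η) (blowupAlgebra (Ideal.span (Set.range c)) (c j))) =
            maximalIdeal (X₁.presheaf.stalk η) →
          IsDomain (Localization.AtPrime 𝔔.asIdeal) ∧ ∀ d : ℕ, ringKrullDim (Localization.AtPrime 𝔔.asIdeal) = d →
            ∀ s : Fin d → Localization.AtPrime 𝔔.asIdeal, (Ideal.span (Set.range s)).radical.IsMaximal →
              RingTheory.Sequence.IsWeaklyRegular (Localization.AtPrime 𝔔.asIdeal) (List.ofFn s) ∧
              ∀ y : Localization.AtPrime 𝔔.asIdeal, (∃ e : ℕ, y ^ p ^ e ∈ Ideal.span ((fun z : Localization.AtPrime 𝔔.asIdeal => z ^ p ^ e) ''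
                (Ideal.span (Set.range s) : Set (Localization.AtPrime 𝔔.asIdeal)))) → y ∈ Ideal.span (Set.range s)) →
      ∃ (J : X₁.IdealSheafData) (n' : ℕ) (c' : Fin n' → X₁.presheaf.stalk η), J ≠ ⊥ ∧ η ∈ (J.support : Set X₁) ∧
      -- the RE-CHOSEN LocFix datum c' at η (currency (A′)): nonzero, inside 𝔪_η, charts FULL over 𝔪_η
      Ideal.span (Set.range c') ≠ ⊥ ∧ Ideal.span (Set.range c') ≤ maximalIdeal (X₁.presheaf.stalk η) ∧
        (∀ (j : Fin n') (𝔔 : PrimeSpectrum (blowupAlgebra (Ideal.span (Set.range c')) (c' j))),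
          𝔔.asIdeal.comap (algebraMap (X₁.presheaf.stalk η) (blowupAlgebra (Ideal.span (Set.range c')) (c' j))) =
            maximalIdeal (X₁.presheaf.stalk η) →
          IsDomain (Localization.AtPrime 𝔔.asIdeal) ∧ ∀ d : ℕ, ringKrullDim (Localization.AtPrime 𝔔.asIdeal) = d →
            ∀ s : Fin d → Localization.AtPrime 𝔔.asIdeal, (Ideal.span (Set.range s)).radical.IsMaximal →
              RingTheory.Sequence.IsWeaklyRegular (Localization.AtPrime 𝔔.asIdeal) (List.ofFn s) ∧
              ∀ y : Localization.AtPrime 𝔔.asIdeal, (∃ e : ℕ, y ^ p ^ e ∈ Ideal.span ((fun z : Localization.AtPrime 𝔔.asIdeal => z ^ p ^ e) ''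
                (Ideal.span (Set.range s) : Set (Localization.AtPrime 𝔔.asIdeal)))) → y ∈ Ideal.span (Set.range s)) ∧
      stalkIdeal J η = Ideal.span (Set.range c') ∧
      (∀ (X₂ : Scheme.{0}) (π : X₂ ⟶ X₁), IsBlowup π J →
        (∀ x : X₂, π.base x ∈ (J.support : Set X₁) → π.base x ≠ η → ¬ IsClosed ({x} : Set X₂) →
          IsDomain (X₂.presheaf.stalk x) ∧ ∀ d : ℕ, ringKrullDim (X₂.presheaf.stalk x) = d → ∀ s : Fin d → X₂.presheaf.stalk x,
            (Ideal.span (Set.range s)).radical.IsMaximal → RingTheory.Sequence.IsWeaklyRegular (X₂.presheaf.stalk x) (List.ofFn s) ∧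
            ∀ t : X₂.presheaf.stalk x, (∃ e : ℕ, t ^ p ^ e ∈ Ideal.span ((fun z : X₂.presheaf.stalk x => z ^ p ^ e) ''
              (Ideal.span (Set.range s) : Set (X₂.presheaf.stalk x)))) → t ∈ Ideal.span (Set.range s)) ∧
        (∀ x : X₂, π.base x ∈ (J.support : Set X₁) → IsClosed ({x} : Set X₂) →
          ∀ d : ℕ, ringKrullDim (X₂.presheaf.stalk x) = d → ∀ s : Fin d → X₂.presheaf.stalk x,
            (Ideal.span (Set.range s)).radical.IsMaximal → RingTheory.Sequence.IsWeaklyRegular (X₂.presheaf.stalk x) (List.ofFn s)))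

/-! ## FC′ (all dimensions) from resolution by one blowing up (T1-type sanity: FC′ is not stronger than resolution) -/

/-- [OURS] **FC′ is implied by one-blow-up resolution of integral varieties in characteristic `p`** (so FC′ is not a
strengthening of resolution; T1-type sanity). The hypothesis is spelled inline; it is the all-dimension analogue of the
conclusion of `exists_isBlowup_isRegular_of_dim_three`. [folklore assembly] -/
theorem fcForallExists_of_oneBlowupResolution
    (hRes : ∀ (p : ℕ), p.Prime → ∀ (k : Type) [Field k] [CharP k p] (X₁ : Scheme.{0}) (f₁ : X₁ ⟶ Spec (.of k)),
      IsSeparated f₁ → LocallyOfFiniteType f₁ → QuasiCompact f₁ → IsIntegral X₁ →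
        ∃ (𝓛 : X₁.IdealSheafData) (T : Scheme.{0}) (ρ : T ⟶ X₁), 𝓛 ≠ ⊥ ∧ IsBlowup ρ 𝓛 ∧ Scheme.IsRegular T) :
    FCForallExists := by
  intro p hp k _ _ X₁ f₁ hsep hft hqc hint _hCM η hη _n _c _hc0 _hrad _hgood
  haveI := hft; haveI := hqc; haveI := hint
  obtain ⟨𝓛, T, ρ, h𝓛, hbl, hreg⟩ := hRes p hp k X₁ f₁ hsep hft hqc hint
  exact fc_witness_of_regular_blowup p hp k X₁ f₁ η hη.2.1 𝓛 h𝓛 T ρ hbl hreg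

/-! ## The FC′ stub SPLIT BY DIMENSION: the rungs `dim ≤ 2` (`…FCForallExistsDimLe2`) and `dim = 3` (above) are
discharged modulo named inputs; the residual piece — the whole remaining difficulty of `stub_fcForallExists` — is `dim ≥ 4` -/


/-- [OURS] **FC′ in dimension ≥ 4** — `GenericFibreReduction.FCForallExists` VERBATIM with the single extra hypothesis
`4 ≤ topologicalKrullDim X₁` inserted after `IsIntegral X₁`. This is the RESIDUAL of the dimension split: nothing in the tree
or in this file bears on it (census v4.4 §15 d ≥ 4: relative F-injective Macaulayfication / SFF(4)). [candidate statement, OURS] -/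
@[conjecture] def FCForallExistsDimGe4 : Prop :=
  ∀ (p : ℕ), p.Prime → ∀ (k : Type) [Field k] [CharP k p]
    (X₁ : Scheme.{0}) (f₁ : X₁ ⟶ Spec (.of k)),
      IsSeparated f₁ → LocallyOfFiniteType f₁ → QuasiCompact f₁ → IsIntegral X₁ → 4 ≤ topologicalKrullDim X₁ →
      (∀ x : X₁, (∀ d : ℕ, ringKrullDim (X₁.presheaf.stalk x) = d → ∀ s : Fin d → X₁.presheaf.stalk x,
        (Ideal.span (Set.range s)).radical.IsMaximal → RingTheory.Sequence.IsWeaklyRegular (X₁.presheaf.stalk x) (List.ofFn s))) →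
      ∀ η : X₁, (¬ IsClosed ({η} : Set X₁) ∧ ¬ (∀ d : ℕ, ringKrullDim (X₁.presheaf.stalk η) = d → ∀ s : Fin d → X₁.presheaf.stalk η,
          (Ideal.span (Set.range s)).radical.IsMaximal → ∀ t : X₁.presheaf.stalk η, (∃ e : ℕ, t ^ p ^ e ∈
            Ideal.span ((fun z : X₁.presheaf.stalk η => z ^ p ^ e) '' (Ideal.span (Set.range s) : Set (X₁.presheaf.stalk η)))) →
              t ∈ Ideal.span (Set.range s)) ∧
        ∀ y : X₁, y ⤳ η → y ≠ η → (∀ d : ℕ, ringKrullDim (X₁.presheaf.stalk y) = d → ∀ s : Fin d → X₁.presheaf.stalk y,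
          (Ideal.span (Set.range s)).radical.IsMaximal → ∀ t : X₁.presheaf.stalk y, (∃ e : ℕ, t ^ p ^ e ∈
            Ideal.span ((fun z : X₁.presheaf.stalk y => z ^ p ^ e) '' (Ideal.span (Set.range s) : Set (X₁.presheaf.stalk y)))) →
              t ∈ Ideal.span (Set.range s))) →
      ∀ (n : ℕ) (c : Fin n → X₁.presheaf.stalk η), Ideal.span (Set.range c) ≠ ⊥ →
        (Ideal.span (Set.range c)).radical = maximalIdeal (X₁.presheaf.stalk η) →
        (∀ (j : Fin n) (𝔔 : PrimeSpectrum (blowupAlgebra (Ideal.span (Set.range c)) (c j))),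
          𝔔.asIdeal.comap (algebraMap (X₁.presheaf.stalk η) (blowupAlgebra (Ideal.span (Set.range c)) (c j))) =
            maximalIdeal (X₁.presheaf.stalk η) →
          IsDomain (Localization.AtPrime 𝔔.asIdeal) ∧ ∀ d : ℕ, ringKrullDim (Localization.AtPrime 𝔔.asIdeal) = d →
            ∀ s : Fin d → Localization.AtPrime 𝔔.asIdeal, (Ideal.span (Set.range s)).radical.IsMaximal →
              RingTheory.Sequence.IsWeaklyRegular (Localization.AtPrime 𝔔.asIdeal) (List.ofFn s) ∧
              ∀ y : Localization.AtPrime 𝔔.asIdeal, (∃ e : ℕ, y ^ p ^ e ∈ Ideal.span ((fun z : Localization.AtPrime 𝔔.asIdeal => z ^ p ^ e) ''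
                (Ideal.span (Set.range s) : Set (Localization.AtPrime 𝔔.asIdeal)))) → y ∈ Ideal.span (Set.range s)) →
      ∃ (J : X₁.IdealSheafData) (n' : ℕ) (c' : Fin n' → X₁.presheaf.stalk η), J ≠ ⊥ ∧ η ∈ (J.support : Set X₁) ∧
      -- the RE-CHOSEN LocFix datum c' at η (currency (A′)): nonzero, inside 𝔪_η, charts FULL over 𝔪_η
      Ideal.span (Set.range c') ≠ ⊥ ∧ Ideal.span (Set.range c') ≤ maximalIdeal (X₁.presheaf.stalk η) ∧
        (∀ (j : Fin n') (𝔔 : PrimeSpectrum (blowupAlgebra (Ideal.span (Set.range c')) (c' j))),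
          𝔔.asIdeal.comap (algebraMap (X₁.presheaf.stalk η) (blowupAlgebra (Ideal.span (Set.range c')) (c' j))) =
            maximalIdeal (X₁.presheaf.stalk η) →
          IsDomain (Localization.AtPrime 𝔔.asIdeal) ∧ ∀ d : ℕ, ringKrullDim (Localization.AtPrime 𝔔.asIdeal) = d →
            ∀ s : Fin d → Localization.AtPrime 𝔔.asIdeal, (Ideal.span (Set.range s)).radical.IsMaximal →
              RingTheory.Sequence.IsWeaklyRegular (Localization.AtPrime 𝔔.asIdeal) (List.ofFn s) ∧
              ∀ y : Localization.AtPrime 𝔔.asIdeal, (∃ e : ℕ, y ^ p ^ e ∈ Ideal.span ((fun z : Localization.AtPrime 𝔔.asIdeal => z ^ p ^ e) ''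
                (Ideal.span (Set.range s) : Set (Localization.AtPrime 𝔔.asIdeal)))) → y ∈ Ideal.span (Set.range s)) ∧
      stalkIdeal J η = Ideal.span (Set.range c') ∧
      (∀ (X₂ : Scheme.{0}) (π : X₂ ⟶ X₁), IsBlowup π J →
        (∀ x : X₂, π.base x ∈ (J.support : Set X₁) → π.base x ≠ η → ¬ IsClosed ({x} : Set X₂) →
          IsDomain (X₂.presheaf.stalk x) ∧ ∀ d : ℕ, ringKrullDim (X₂.presheaf.stalk x) = d → ∀ s : Fin d → X₂.presheaf.stalk x,
            (Ideal.span (Set.range s)).radical.IsMaximal → RingTheory.Sequence.IsWeaklyRegular (X₂.presheaf.stalk x) (List.ofFn s) ∧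
            ∀ t : X₂.presheaf.stalk x, (∃ e : ℕ, t ^ p ^ e ∈ Ideal.span ((fun z : X₂.presheaf.stalk x => z ^ p ^ e) ''
              (Ideal.span (Set.range s) : Set (X₂.presheaf.stalk x)))) → t ∈ Ideal.span (Set.range s)) ∧
        (∀ x : X₂, π.base x ∈ (J.support : Set X₁) → IsClosed ({x} : Set X₂) →
          ∀ d : ℕ, ringKrullDim (X₂.presheaf.stalk x) = d → ∀ s : Fin d → X₂.presheaf.stalk x,
            (Ideal.span (Set.range s)).radical.IsMaximal → RingTheory.Sequence.IsWeaklyRegular (X₂.presheaf.stalk x) (List.ofFn s)))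

/-- Trichotomy of a dimension value. [plumbing] -/
theorem dim_trichotomy (d : WithBot ℕ∞) : d ≤ 2 ∨ d = 3 ∨ 4 ≤ d := by
  induction d using WithBot.recBotCoe with
  | bot => exact Or.inl bot_le
  | coe a =>
    induction a using ENat.recTopCoe with
    | top =>
      refine Or.inr (Or.inr ?_)
      rw [← WithBot.coe_ofNat, WithBot.coe_le_coe]; exact le_top
    | coe n =>
      rcases Nat.lt_or_ge n 3 with h | h
      · refine Or.inl ?_
        rw [← WithBot.coe_ofNat, WithBot.coe_le_coe]
        exact_mod_cast (show n ≤ 2 by omega)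
      · rcases h.eq_or_lt with h' | h'
        · refine Or.inr (Or.inl ?_)
          rw [← WithBot.coe_ofNat, WithBot.coe_inj]
          exact_mod_cast h'.symm
        · refine Or.inr (Or.inr ?_)
          rw [← WithBot.coe_ofNat, WithBot.coe_le_coe]
          exact_mod_cast (show 4 ≤ n by omega)

/-- [OURS] **the dimension split of FC′ is exhaustive**: `FC′(dim ≤ 2) → FC′(dim = 3) → FC′(dim ≥ 4) → FC′`. [plumbing] -/
theorem fcForallExists_of_rungs (h2 : FCForallExistsDimLe2) (h3 : FCForallExistsDimEq3) (h4 : FCForallExistsDimGe4) :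
    FCForallExists := by
  intro p hp k _ _ X₁ f₁ hsep hft hqc hint
  rcases dim_trichotomy (topologicalKrullDim X₁) with hd | hd | hd
  · exact h2 p hp k X₁ f₁ hsep hft hqc hint hd
  · exact h3 p hp k X₁ f₁ hsep hft hqc hint hd
  · exact h4 p hp k X₁ f₁ hsep hft hqc hint hd

/-- Sanity: each piece is a weakening of FC′ (so the split is an honest case split, no piece is stronger than FC′). -/
theorem rungs_of_fcForallExists (h : FCForallExists) :
    FCForallExistsDimLe2 ∧ FCForallExistsDimEq3 ∧ FCForallExistsDimGe4 :=
  ⟨fcForallExistsDimLe2_of_fc h,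
    fun p hp k _ _ X₁ f₁ hsep hft hqc hint _ => h p hp k X₁ f₁ hsep hft hqc hint,
    fun p hp k _ _ X₁ f₁ hsep hft hqc hint _ => h p hp k X₁ f₁ hsep hft hqc hint⟩

/-- [OURS] **THE v29 STUB `stub_fcForallExists` MODULO NAMED INPUTS, THE DIM-3 RUNG AND ITS DIMENSION-≥-4 RESIDUAL** (variant WITHOUT the
Cossart–Piltant/Stacks 081R named facts, which are not FACT-LIST §A entries at filing time — plan-1 R13.26 (1)): FC′ follows from Datta–Murayama 2024
Thm. B (route named fact, BY NAME), Cohen–Macaulay openness, S-S2, S-V, FC′ in dimension 3 and FC′ in dimension ≥ 4. Sorry-free. The dim-3 rung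
`FCForallExistsDimEq3` is discharged SEPARATELY from `CossartPiltant2019General` + `Stacks081R` + `CossartPiltant2019Principalization` through the tree's
`FCForallExistsCylinder.exists_isBlowup_isRegular_of_dim_three` and `fc_witness_of_regular_blowup` (cell file `r2-split/F5_FCForallExistsRungs.lean`, its
`fcForallExistsDimEq3_of_CP`), to be landed when those facts are admitted. [candidate kernel, OURS · AI-written] -/
theorem fcForallExists_of_dimGe4_named
    (hDM : Literature.AlgebraicGeometry.Resolution.DattaMurayama2024_fInjectiveLocusOpen.{0}) (hCMo : CMLocusOpen)
    (hS2 : S2Modification) (hV : FiniteModificationOfBlowupIsBlowup)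
    (h3 : FCForallExistsDimEq3) (h4 : FCForallExistsDimGe4) : FCForallExists :=
  fcForallExists_of_rungs (fcForallExistsDimLe2_of_named hDM hCMo hS2 hV) h3 h4

/-- **Ladder kernel with the S-V split (variant without the CP2019 facts):** given the named facts and CM-openness,
`stub_fcForallExists` ⟸ S-S2 ∧ S-V1 ∧ S-V2 ∧ FC′(dim = 3) ∧ FC′(dim ≥ 4). [OURS assembly] -/
theorem fcForallExists_of_dimGe4_named'
    (hDM : Literature.AlgebraicGeometry.Resolution.DattaMurayama2024_fInjectiveLocusOpen.{0})
    (hCMo : CMLocusOpen) (hS2 : S2Modification) (hV1 : ConductorIdealExists) (hV2 : IsBlowupOfFiniteOfStable)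
    (h3 : FCForallExistsDimEq3) (h4 : FCForallExistsDimGe4) : FCForallExists :=
  fcForallExists_of_dimGe4_named hDM hCMo hS2 (FiniteModificationOfBlowup.finiteModificationOfBlowupIsBlowup_of hV1 hV2) h3 h4

end Summit.ResolutionOfSingularities.ResolutionOfSingularities.Theorems.FInjectiveMacaulayfication.FCForallExistsRungs

end
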